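import Summits.AtomisticToContinuum.BoseEinsteinCondensation.Theorems.BECThomsonPrincipleFibreConductanceCageDefs
import Summits.AtomisticToContinuum.BoseEinsteinCondensation.Theorems.BECThomsonPrincipleFibreFubini
import Literature.Analysis.FluidPDE.FourierL2Convolution
import HarnessLib

/-!
# Route `BECThomsonPrinciple`, crux `FibreConductance` (stmt-AtomisticToContinuum-9480):
# the condensate floor of the conditional density, and the strength of `ConditionalDensityMoments`

A kinematic inequality for every zero-free periodic trial state `Φ` of `N = m + 1` bosons on the
torus of side `L` (no minimality, no interaction), in the fibre vocabulary of
`BECThomsonPrincipleDefs` (`W`, `ψ`; `g := L³ψ²` is the normalised conditional density of particle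
`0` given the bath, `⨍_cell g dy = 1` on every fibre):

* `pow_nine_le` — HÖLDER ON THE CELL: `L⁹ ≤ (∫_cell ψ dy)² · ∫_cell ψ⁻² dy` on every fibre
  (`L³ = ∫ ψ^{2/3} ψ^{-2/3}`; two Cauchy–Schwarz steps, `FourierNS.sq_lintegral_mul_le`);
* `inv_norm_sq_cellFourierCoeff_zero_le` — hence `|ĉ₀(ψ(·|X̂))|⁻² ≤ ∫_cell (L³ψ²)⁻¹ dy = ⨍ g⁻¹`;
* `condensate_floor` — CAUCHY–SCHWARZ IN THE BATH and the fibre Fubini identity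
  `∫_{cellN} W|ĉ₀(ψ)|² = n₀(|Φ|)/N` (`lintegral_fibreW_mul_norm_sq_cellFourierCoeff` at `q = 0`):
  `L³ · N ≤ n₀(|Φ|) · ∫_{cellN} W · g⁻¹ dX`, i.e. **condensate fraction of `|Φ|`
  `≥ 1 / E_{W,unif}[g⁻¹]`** (free gas: equality, `g ≡ 1`).

Consequence for the line programme on this crux (`condensation_of_conditionalDensityMoments`): the
shared landscape stub `ConditionalDensityMoments` of the lines tagged-path-harnack-cage-moments,
conditional-law-poincare and parseval-shell-bootstrap (r4) — already at its FIRST order `p = 1` —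
implies a UNIFORM CONDENSATE FRACTION `n₀(|Φ|) ≥ N/C` for every exact zero-free minimiser at every
density `≤ ρ₀`, every `N ≥ N₀` and every `L`, i.e. Bose–Einstein condensation of the exact periodic
ground states in the thermodynamic limit: the stub has the strength of the sub-problem itself, not
of a "landscape regularity" input — holes of the conditional law at uniform locations ARE depletion
(`1 − (⨍√g)² = ⨍(√g − ⨍√g)²`).

References: LSSY2005 §1.2 (1.17)–(1.18) (occupations); crux workfiles
`Cruxes/FibreConductance/{NOTES.md, PICKED.md}`.
-/

noncomputable section

namespace Summit.AtomisticToContinuum.BoseEinsteinCondensation.Cruxes.FibreConductance.CondensateFloor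

open MeasureTheory
open scoped ENNReal
open Literature.MathematicalPhysics.QuantumManyBody.BoseGas
open Summit.AtomisticToContinuum.BoseEinsteinCondensation.Cruxes.FibreConductance.ParsevalShellBootstrap
  (fibreW fibrePsi fibreW_update fibreW_pos fibreW_nonneg fibrePsi_pos fibrePsi_nonneg continuous_fibrePsi
    continuous_fibreW continuous_update_zero exists_fibre_bounds lintegral_cellN_fibreW
    lintegral_cellN_eq_fibre_average lintegral_fibreW_mul_norm_sq_cellFourierCoeff
    continuous_cellFourierCoeff_fibrePsi measurable_fibreW measurable_fibrePsi)
open Summit.AtomisticToContinuum.BoseEinsteinCondensation.Cruxes.FibreConductance.TaggedPathHarnack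
  (ConditionalDensityMoments)
open Literature.Analysis.FluidPDE.FourierNS (sq_lintegral_mul_le)

variable {m : ℕ} {L : ℝ}

/-! ### Hölder on the cell: the zero mode of the conditional amplitude against the inverse moment -/
/-- The fibre slice `y ↦ ψ(y | X̂)` is continuous. [folklore] -/
theorem continuous_fibrePsi_slice (hL : 0 < L) (Φ : PeriodicTrialState (m + 1) L)
    (hΦ : ∀ X, Φ.ψ X ≠ 0) (X : Config (m + 1)) :
    Continuous fun y : Space => fibrePsi Φ (Function.update X 0 y) :=
  (continuous_fibrePsi hL Φ hΦ).comp (continuous_const.update 0 continuous_id)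

/-- **Hölder on the cell**: on every fibre `L⁹ ≤ (∫_cell ψ dy)² · ∫_cell ψ⁻² dy`
(`L³ = ∫_cell ψ^{2/3}·ψ^{-2/3}`, written as the two Cauchy–Schwarz steps
`(∫1)² ≤ ∫ψ·∫ψ⁻¹` and `(∫ψ⁻¹)² ≤ ∫1·∫ψ⁻²`). [folklore] -/
theorem pow_nine_le (hL : 0 < L) (Φ : PeriodicTrialState (m + 1) L) (hΦ : ∀ X, Φ.ψ X ≠ 0)
    (X : Config (m + 1)) :
    L ^ 9 ≤ (∫ y in cell L, fibrePsi Φ (Function.update X 0 y)) ^ 2 *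
      ∫ y in cell L, (fibrePsi Φ (Function.update X 0 y) ^ 2)⁻¹ := by
  set u : Space → ℝ := fun y => fibrePsi Φ (Function.update X 0 y) with hu
  have hu_pos : ∀ y, 0 < u y := fun y => fibrePsi_pos hL Φ hΦ _
  have hu_cont : Continuous u := continuous_fibrePsi_slice hL Φ hΦ X
  set μ : Measure Space := volume.restrict (cell L) with hμ
  have hV : μ Set.univ = ENNReal.ofReal L ^ 3 := by
    rw [hμ, Measure.restrict_apply_univ, volume_cell]
  have hV0 : μ Set.univ ≠ 0 := by rw [hV]; exact pow_ne_zero _ (by simpa using hL)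
  have hVtop : μ Set.univ ≠ ⊤ := by rw [hV]; exact ENNReal.pow_ne_top ENNReal.ofReal_ne_top
  haveI : IsFiniteMeasure μ := ⟨lt_top_iff_ne_top.2 hVtop⟩
  -- the three lower integrals
  set A : ℝ≥0∞ := ∫⁻ y, ENNReal.ofReal (u y) ∂μ with hA
  set P : ℝ≥0∞ := ∫⁻ y, ENNReal.ofReal (u y)⁻¹ ∂μ with hP
  set Q : ℝ≥0∞ := ∫⁻ y, ENNReal.ofReal ((u y) ^ 2)⁻¹ ∂μ with hQ
  have hmeas_u : Measurable u := hu_cont.measurable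
  -- CS1: `V² ≤ A P`
  have h1 : μ Set.univ ^ 2 ≤ A * P := by
    have hcs := sq_lintegral_mul_le μ
      (f := fun y => ENNReal.ofReal (Real.sqrt (u y)))
      (g := fun y => (ENNReal.ofReal (Real.sqrt (u y)))⁻¹)
      (hmeas_u.sqrt.ennreal_ofReal).aemeasurable
      ((hmeas_u.sqrt.ennreal_ofReal).inv).aemeasurable
    have hfg : ∀ y, ENNReal.ofReal (Real.sqrt (u y)) * (ENNReal.ofReal (Real.sqrt (u y)))⁻¹ = 1 := by
      intro y
      exact ENNReal.mul_inv_cancel (by simpa using Real.sqrt_pos.2 (hu_pos y)) ENNReal.ofReal_ne_top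
    have hf2 : ∀ y, ENNReal.ofReal (Real.sqrt (u y)) ^ 2 = ENNReal.ofReal (u y) := by
      intro y
      rw [← ENNReal.ofReal_pow (Real.sqrt_nonneg _), Real.sq_sqrt (hu_pos y).le]
    have hg2 : ∀ y, (ENNReal.ofReal (Real.sqrt (u y)))⁻¹ ^ 2 = ENNReal.ofReal (u y)⁻¹ := by
      intro y
      rw [← ENNReal.inv_pow, hf2, ENNReal.ofReal_inv_of_pos (hu_pos y)]
    simp only [hfg, lintegral_const, one_mul, hf2, hg2] at hcs
    exact hcs
  -- CS2: `P² ≤ V Q`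
  have h2 : P ^ 2 ≤ μ Set.univ * Q := by
    have hcs := sq_lintegral_mul_le μ (f := fun _ => (1 : ℝ≥0∞))
      (g := fun y => ENNReal.ofReal (u y)⁻¹) aemeasurable_const
      (hmeas_u.inv.ennreal_ofReal).aemeasurable
    have hg2 : ∀ y, ENNReal.ofReal (u y)⁻¹ ^ 2 = ENNReal.ofReal ((u y) ^ 2)⁻¹ := by
      intro y
      rw [← ENNReal.ofReal_pow (inv_nonneg.2 (hu_pos y).le), inv_pow]
    simp only [one_mul, one_pow, lintegral_const, hg2] at hcs
    exact hcs
  -- combine: `V³ ≤ A² Q`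
  have h3 : μ Set.univ ^ 3 ≤ A ^ 2 * Q := by
    have h4 : μ Set.univ ^ 4 ≤ A ^ 2 * Q * μ Set.univ := by
      calc μ Set.univ ^ 4 = (μ Set.univ ^ 2) ^ 2 := by ring
        _ ≤ (A * P) ^ 2 := by gcongr
        _ = A ^ 2 * P ^ 2 := by ring
        _ ≤ A ^ 2 * (μ Set.univ * Q) := by gcongr
        _ = A ^ 2 * Q * μ Set.univ := by ring
    exact (ENNReal.mul_le_mul_iff_left hV0 hVtop).1 (le_of_eq_of_le (by ring) h4)
  -- back to real integrals
  obtain ⟨c, C, hc, hcψ, hψC, -, -⟩ := exists_fibre_bounds hL Φ hΦ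
  have hint_u : Integrable u μ := by
    refine ⟨hmeas_u.aestronglyMeasurable, ?_⟩
    refine HasFiniteIntegral.of_bounded (C := C) (Filter.Eventually.of_forall fun y => ?_)
    rw [Real.norm_of_nonneg (hu_pos y).le]
    exact hψC _
  have hint_q : Integrable (fun y => ((u y) ^ 2)⁻¹) μ := by
    refine ⟨(hmeas_u.pow_const 2).inv.aestronglyMeasurable, ?_⟩
    refine HasFiniteIntegral.of_bounded (C := (c ^ 2)⁻¹) (Filter.Eventually.of_forall fun y => ?_)
    rw [Real.norm_of_nonneg (inv_nonneg.2 (sq_nonneg _))]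
    exact inv_anti₀ (pow_pos hc 2) (pow_le_pow_left₀ hc.le (hcψ _) 2)
  have hA' : A = ENNReal.ofReal (∫ y, u y ∂μ) :=
    (ofReal_integral_eq_lintegral_ofReal hint_u
      (Filter.Eventually.of_forall fun y => (hu_pos y).le)).symm
  have hQ' : Q = ENNReal.ofReal (∫ y, ((u y) ^ 2)⁻¹ ∂μ) :=
    (ofReal_integral_eq_lintegral_ofReal hint_q
      (Filter.Eventually.of_forall fun y => inv_nonneg.2 (sq_nonneg _))).symm
  have hposA : 0 ≤ ∫ y, u y ∂μ := integral_nonneg fun y => (hu_pos y).le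
  have hposQ : 0 ≤ ∫ y, ((u y) ^ 2)⁻¹ ∂μ := integral_nonneg fun y => inv_nonneg.2 (sq_nonneg _)
  rw [hV, ← ENNReal.ofReal_pow hL.le, ← ENNReal.ofReal_pow (pow_nonneg hL.le 3), hA', hQ',
    ← ENNReal.ofReal_pow hposA, ← ENNReal.ofReal_mul (pow_nonneg hposA 2)] at h3
  have h3' := (ENNReal.ofReal_le_ofReal_iff (mul_nonneg (pow_nonneg hposA 2) hposQ)).1 h3
  show L ^ 9 ≤ (∫ y, u y ∂μ) ^ 2 * ∫ y, ((u y) ^ 2)⁻¹ ∂μ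
  calc L ^ 9 = (L ^ 3) ^ 3 := by ring
    _ ≤ _ := h3'

/-- The zero Fourier mode of the conditional amplitude is its cell mean: a positive real,
`ĉ₀(ψ(·|X̂)) = L⁻³ ∫_cell ψ dy`. [folklore] -/
theorem norm_cellFourierCoeff_zero_fibrePsi (hL : 0 < L) (Φ : PeriodicTrialState (m + 1) L)
    (X : Config (m + 1)) :
    ‖cellFourierCoeff L (fun y => (fibrePsi Φ (Function.update X 0 y) : ℂ)) 0‖ =
      (L ^ 3)⁻¹ * ∫ y in cell L, fibrePsi Φ (Function.update X 0 y) := by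
  rw [cellFourierCoeff_zero hL, integral_complex_ofReal, Complex.real_smul, norm_mul, Complex.norm_real,
    Complex.norm_real, Real.norm_of_nonneg (inv_nonneg.2 (pow_nonneg hL.le 3)),
    Real.norm_of_nonneg (integral_nonneg fun y => fibrePsi_nonneg Φ _)]

/-- **Inverse zero mode against the inverse moment**: on every fibre
`|ĉ₀(ψ(·|X̂))|⁻² ≤ ∫_cell (L³ψ²)⁻¹ dy = ⨍_cell g⁻¹` (`g = L³ψ²`), by `pow_nine_le`. [folklore] -/
theorem inv_norm_sq_cellFourierCoeff_zero_le (hL : 0 < L) (Φ : PeriodicTrialState (m + 1) L)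
    (hΦ : ∀ X, Φ.ψ X ≠ 0) (X : Config (m + 1)) :
    (‖cellFourierCoeff L (fun y => (fibrePsi Φ (Function.update X 0 y) : ℂ)) 0‖ ^ 2)⁻¹ ≤
      ∫ y in cell L, (L ^ 3 * fibrePsi Φ (Function.update X 0 y) ^ 2)⁻¹ := by
  set A : ℝ := ∫ y in cell L, fibrePsi Φ (Function.update X 0 y) with hA
  set Q : ℝ := ∫ y in cell L, (fibrePsi Φ (Function.update X 0 y) ^ 2)⁻¹ with hQ
  have h9 : L ^ 9 ≤ A ^ 2 * Q := pow_nine_le hL Φ hΦ X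
  have hL3 : 0 < L ^ 3 := pow_pos hL 3
  have hQ0 : 0 ≤ Q := integral_nonneg fun y => inv_nonneg.2 (sq_nonneg _)
  have hA0 : 0 ≤ A := integral_nonneg fun y => fibrePsi_nonneg Φ _
  have hAQ : 0 < A ^ 2 * Q := (pow_pos hL 9).trans_le h9
  have hA2 : 0 < A ^ 2 := by
    rcases (sq_nonneg A).lt_or_eq with h | h; · exact h
    rw [← h, zero_mul] at hAQ; exact absurd hAQ (lt_irrefl 0)
  have hQpos : 0 < Q := by
    rcases hQ0.lt_or_eq with h | h; · exact h
    rw [← h, mul_zero] at hAQ; exact absurd hAQ (lt_irrefl 0)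
  have hrw : (fun y => (L ^ 3 * fibrePsi Φ (Function.update X 0 y) ^ 2)⁻¹) =
      fun y => (L ^ 3)⁻¹ * (fibrePsi Φ (Function.update X 0 y) ^ 2)⁻¹ := by
    funext y; rw [mul_inv]
  rw [norm_cellFourierCoeff_zero_fibrePsi hL Φ X, hrw, integral_const_mul, ← hA, ← hQ,
    show (((L ^ 3)⁻¹ * A) ^ 2)⁻¹ = (L ^ 3) ^ 2 / A ^ 2 by
      rw [mul_pow, mul_inv, inv_pow, inv_inv, div_eq_mul_inv],
    show (L ^ 3)⁻¹ * Q = Q / L ^ 3 by rw [inv_mul_eq_div],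
    div_le_div_iff₀ hA2 hL3]
  calc (L ^ 3) ^ 2 * L ^ 3 = L ^ 9 := by ring
    _ ≤ A ^ 2 * Q := h9
    _ = Q * A ^ 2 := by ring

/-- The cell mean of the conditional amplitude is positive on every fibre. [folklore] -/
theorem integral_fibrePsi_slice_pos (hL : 0 < L) (Φ : PeriodicTrialState (m + 1) L)
    (hΦ : ∀ X, Φ.ψ X ≠ 0) (X : Config (m + 1)) :
    0 < ∫ y in cell L, fibrePsi Φ (Function.update X 0 y) := by
  set A : ℝ := ∫ y in cell L, fibrePsi Φ (Function.update X 0 y) with hA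
  have h9 := pow_nine_le hL Φ hΦ X
  have hAQ : 0 < A ^ 2 * ∫ y in cell L, (fibrePsi Φ (Function.update X 0 y) ^ 2)⁻¹ :=
    (pow_pos hL 9).trans_le h9
  have hA0 : 0 ≤ A := integral_nonneg fun y => fibrePsi_nonneg Φ _
  rcases hA0.lt_or_eq with h | h; · exact h
  rw [← h] at hAQ; norm_num at hAQ

/-- The zero mode `|ĉ₀(ψ(·|X̂))| = L⁻³∫_cell ψ` is positive on every fibre. [folklore] -/
theorem norm_cellFourierCoeff_zero_fibrePsi_pos (hL : 0 < L) (Φ : PeriodicTrialState (m + 1) L)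
    (hΦ : ∀ X, Φ.ψ X ≠ 0) (X : Config (m + 1)) :
    0 < ‖cellFourierCoeff L (fun y => (fibrePsi Φ (Function.update X 0 y) : ℂ)) 0‖ := by
  rw [norm_cellFourierCoeff_zero_fibrePsi hL Φ X]
  exact mul_pos (inv_pos.2 (pow_pos hL 3)) (integral_fibrePsi_slice_pos hL Φ hΦ X)

/-- The inverse conditional density `y ↦ (L³ψ(y|X̂)²)⁻¹` is continuous on the fibre. [folklore] -/
theorem continuous_inv_condDensity_slice (hL : 0 < L) (Φ : PeriodicTrialState (m + 1) L)
    (hΦ : ∀ X, Φ.ψ X ≠ 0) (X : Config (m + 1)) :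
    Continuous fun y : Space => (L ^ 3 * fibrePsi Φ (Function.update X 0 y) ^ 2)⁻¹ :=
  (continuous_const.mul ((continuous_fibrePsi_slice hL Φ hΦ X).pow 2)).inv₀ fun _ =>
    (mul_pos (pow_pos hL 3) (pow_pos (fibrePsi_pos hL Φ hΦ _) 2)).ne'

/-- **Fibre Fubini for the inverse moment**: spreading the fibre integral `⨍ g⁻¹` over the fibre,
`∫_{cellN} W(X̂)·(∫_cell (L³ψ(y|X̂)²)⁻¹dy) dX = L³ · ∫_{cellN} W·(L³ψ²)⁻¹ dX`. [folklore] -/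
theorem lintegral_fibreW_mul_inverseMoment (hL : 0 < L) (Φ : PeriodicTrialState (m + 1) L)
    (hΦ : ∀ X, Φ.ψ X ≠ 0) :
    ∫⁻ X in cellN (m + 1) L, ENNReal.ofReal
        (fibreW Φ X * ∫ y in cell L, (L ^ 3 * fibrePsi Φ (Function.update X 0 y) ^ 2)⁻¹) =
      ENNReal.ofReal (L ^ 3) *
        ∫⁻ X in cellN (m + 1) L, ENNReal.ofReal (fibreW Φ X * (L ^ 3 * fibrePsi Φ X ^ 2)⁻¹) := by
  have hL3 : ENNReal.ofReal (L ^ 3) ≠ 0 := by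
    simpa [ENNReal.ofReal_eq_zero, not_le] using pow_pos hL 3
  have hmeas : Measurable fun X : Config (m + 1) =>
      ENNReal.ofReal (fibreW Φ X * (L ^ 3 * fibrePsi Φ X ^ 2)⁻¹) :=
    ((measurable_fibreW Φ).mul
      (measurable_const.mul ((measurable_fibrePsi hL Φ hΦ).pow_const 2)).inv).ennreal_ofReal
  rw [lintegral_cellN_eq_fibre_average hL hmeas, ← mul_assoc, ENNReal.mul_inv_cancel hL3
    ENNReal.ofReal_ne_top, one_mul]
  refine setLIntegral_congr_fun (measurableSet_cellN (m + 1) L) fun X _ => ?_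
  -- on the fibre of `X`: `W` is constant and the inner lower integral is a Bochner integral
  have hW : 0 ≤ fibreW Φ X := fibreW_nonneg Φ X
  have hk : Continuous fun y : Space => (L ^ 3 * fibrePsi Φ (Function.update X 0 y) ^ 2)⁻¹ :=
    continuous_inv_condDensity_slice hL Φ hΦ X
  have hk0 : ∀ y, 0 ≤ (L ^ 3 * fibrePsi Φ (Function.update X 0 y) ^ 2)⁻¹ := fun y =>
    inv_nonneg.2 (mul_nonneg (pow_nonneg hL.le 3) (sq_nonneg _))
  have h1 : ∀ y, ENNReal.ofReal (fibreW Φ (Function.update X 0 y) *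
      (L ^ 3 * fibrePsi Φ (Function.update X 0 y) ^ 2)⁻¹) =
        ENNReal.ofReal (fibreW Φ X) *
          ENNReal.ofReal ((L ^ 3 * fibrePsi Φ (Function.update X 0 y) ^ 2)⁻¹) := by
    intro y
    rw [fibreW_update, ENNReal.ofReal_mul hW]
  simp_rw [h1]
  rw [lintegral_const_mul _ hk.measurable.ennreal_ofReal,
    ← ofReal_integral_eq_lintegral_ofReal (integrableOn_cell hk) (Filter.Eventually.of_forall hk0),
    ← ENNReal.ofReal_mul hW]

/-- **The condensate floor of the conditional density** (kinematic; every zero-free periodic trial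
state, no minimality, no interaction): `L³ · N ≤ n₀(|Φ|) · ∫_{cellN} W·(L³ψ²)⁻¹ dX`, i.e. the
condensate fraction of `|Φ|` is at least the reciprocal of the bath-and-uniform average of the
inverse normalised conditional density, `n₀(|Φ|)/N ≥ 1/E_{W,unif}[g⁻¹]` (`g = L³ψ²`). Proof:
`n₀(|Φ|)/N = ∫_{cellN} W |ĉ₀(ψ)|²` (fibre Fubini at the zero mode), Cauchy–Schwarz in the bath
`(∫W)² ≤ ∫W|ĉ₀|² · ∫W|ĉ₀|⁻²`, `|ĉ₀|⁻² ≤ ⨍g⁻¹` (Hölder on the cell), `∫_{cellN} W = L³`. Free gas: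
equality. [folklore] -/
theorem condensate_floor (hL : 0 < L) (Φ : PeriodicTrialState (m + 1) L) (hΦ : ∀ X, Φ.ψ X ≠ 0) :
    ENNReal.ofReal (L ^ 3) * (m + 1 : ℝ≥0∞) ≤
      condensateOccupation (m + 1) L (fun X => (‖Φ.ψ X‖ : ℂ)) *
        ∫⁻ X in cellN (m + 1) L, ENNReal.ofReal (fibreW Φ X * (L ^ 3 * fibrePsi Φ X ^ 2)⁻¹) := by
  set a : Config (m + 1) → ℝ := fun X =>
    ‖cellFourierCoeff L (fun y => (fibrePsi Φ (Function.update X 0 y) : ℂ)) 0‖ with ha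
  set D : ℝ≥0∞ := ∫⁻ X in cellN (m + 1) L,
    ENNReal.ofReal (fibreW Φ X * (L ^ 3 * fibrePsi Φ X ^ 2)⁻¹) with hD
  set n₀ : ℝ≥0∞ := condensateOccupation (m + 1) L (fun X => (‖Φ.ψ X‖ : ℂ)) with hn₀
  have ha_pos : ∀ X, 0 < a X := fun X => norm_cellFourierCoeff_zero_fibrePsi_pos hL Φ hΦ X
  have ha_meas : Measurable a := (continuous_cellFourierCoeff_fibrePsi hL Φ hΦ 0).norm.measurable
  have hW0 : ∀ X, 0 ≤ fibreW Φ X := fibreW_nonneg Φ; have hWm := measurable_fibreW Φ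
  set μ : Measure (Config (m + 1)) := volume.restrict (cellN (m + 1) L) with hμ
  -- Cauchy–Schwarz in the bath
  have hcs := sq_lintegral_mul_le μ
    (f := fun X => ENNReal.ofReal (Real.sqrt (fibreW Φ X) * a X))
    (g := fun X => ENNReal.ofReal (Real.sqrt (fibreW Φ X) * (a X)⁻¹))
    ((hWm.sqrt.mul ha_meas).ennreal_ofReal).aemeasurable
    ((hWm.sqrt.mul ha_meas.inv).ennreal_ofReal).aemeasurable
  have hfg : ∀ X, ENNReal.ofReal (Real.sqrt (fibreW Φ X) * a X) *
      ENNReal.ofReal (Real.sqrt (fibreW Φ X) * (a X)⁻¹) = ENNReal.ofReal (fibreW Φ X) := by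
    intro X
    rw [← ENNReal.ofReal_mul (mul_nonneg (Real.sqrt_nonneg _) (ha_pos X).le)]
    congr 1
    rw [mul_mul_mul_comm, Real.mul_self_sqrt (hW0 X), mul_inv_cancel₀ (ha_pos X).ne', mul_one]
  have hf2 : ∀ X, ENNReal.ofReal (Real.sqrt (fibreW Φ X) * a X) ^ 2 =
      ENNReal.ofReal (fibreW Φ X * a X ^ 2) := by
    intro X
    rw [← ENNReal.ofReal_pow (mul_nonneg (Real.sqrt_nonneg _) (ha_pos X).le), mul_pow,
      Real.sq_sqrt (hW0 X)]
  have hg2 : ∀ X, ENNReal.ofReal (Real.sqrt (fibreW Φ X) * (a X)⁻¹) ^ 2 =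
      ENNReal.ofReal (fibreW Φ X * (a X ^ 2)⁻¹) := by
    intro X
    rw [← ENNReal.ofReal_pow (mul_nonneg (Real.sqrt_nonneg _) (inv_nonneg.2 (ha_pos X).le)),
      mul_pow, Real.sq_sqrt (hW0 X), inv_pow]
  simp only [hfg, hf2, hg2] at hcs
  -- identify the three integrals
  have hW : ∫⁻ X, ENNReal.ofReal (fibreW Φ X) ∂μ = ENNReal.ofReal (L ^ 3) :=
    lintegral_cellN_fibreW hL Φ
  have hF : ∫⁻ X, ENNReal.ofReal (fibreW Φ X * a X ^ 2) ∂μ = n₀ / (m + 1 : ℝ≥0∞) := by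
    have h := lintegral_fibreW_mul_norm_sq_cellFourierCoeff hL Φ hΦ 0
    rw [cellOccupation_planeWaveMode_zero] at h
    exact h
  have hG : ∫⁻ X, ENNReal.ofReal (fibreW Φ X * (a X ^ 2)⁻¹) ∂μ ≤ ENNReal.ofReal (L ^ 3) * D := by
    calc ∫⁻ X, ENNReal.ofReal (fibreW Φ X * (a X ^ 2)⁻¹) ∂μ
        ≤ ∫⁻ X, ENNReal.ofReal (fibreW Φ X *
            ∫ y in cell L, (L ^ 3 * fibrePsi Φ (Function.update X 0 y) ^ 2)⁻¹) ∂μ :=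
          lintegral_mono fun X => ENNReal.ofReal_le_ofReal
            (mul_le_mul_of_nonneg_left (inv_norm_sq_cellFourierCoeff_zero_le hL Φ hΦ X) (hW0 X))
      _ = ENNReal.ofReal (L ^ 3) * D := lintegral_fibreW_mul_inverseMoment hL Φ hΦ
  rw [hW, hF] at hcs
  -- algebra in `ℝ≥0∞`
  have hL3 : ENNReal.ofReal (L ^ 3) ≠ 0 := by
    simpa [ENNReal.ofReal_eq_zero, not_le] using pow_pos hL 3
  have hN0 : (m + 1 : ℝ≥0∞) ≠ 0 := by positivity
  have hNtop : (m + 1 : ℝ≥0∞) ≠ ⊤ := by simp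
  have h1 : ENNReal.ofReal (L ^ 3) ^ 2 ≤ n₀ / (m + 1 : ℝ≥0∞) * (ENNReal.ofReal (L ^ 3) * D) :=
    hcs.trans (by gcongr)
  have h2 : ENNReal.ofReal (L ^ 3) * ENNReal.ofReal (L ^ 3) ≤
      n₀ / (m + 1 : ℝ≥0∞) * D * ENNReal.ofReal (L ^ 3) := by
    calc ENNReal.ofReal (L ^ 3) * ENNReal.ofReal (L ^ 3) = ENNReal.ofReal (L ^ 3) ^ 2 := by ring
      _ ≤ n₀ / (m + 1 : ℝ≥0∞) * (ENNReal.ofReal (L ^ 3) * D) := h1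
      _ = n₀ / (m + 1 : ℝ≥0∞) * D * ENNReal.ofReal (L ^ 3) := by ring
  have h3 : ENNReal.ofReal (L ^ 3) ≤ n₀ / (m + 1 : ℝ≥0∞) * D :=
    (ENNReal.mul_le_mul_iff_left hL3 ENNReal.ofReal_ne_top).1 h2
  have h4 : ENNReal.ofReal (L ^ 3) ≤ n₀ * D / (m + 1 : ℝ≥0∞) := by
    calc ENNReal.ofReal (L ^ 3) ≤ n₀ / (m + 1 : ℝ≥0∞) * D := h3
      _ = n₀ * D / (m + 1 : ℝ≥0∞) := by rw [ENNReal.mul_div_right_comm]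
  exact (ENNReal.le_div_iff_mul_le (Or.inl hN0) (Or.inl hNtop)).1 h4

/-- **`ConditionalDensityMoments` is of the strength of the sub-problem.** The shared landscape
stub of the lines tagged-path-harnack-cage-moments / conditional-law-poincare / parseval-shell-
bootstrap (r4) on this crux, `ConditionalDensityMoments` (CageDefs) — taken at its first order
`p = 1` only — implies a UNIFORM CONDENSATE FRACTION for the modulus of every exact zero-free
minimiser: for bounded repulsive finite-range `v` there are `ρ₀, c > 0, N₀` with
`n₀(|Φ|) ≥ c·N` for all `N ≥ N₀`, all `L > 0` with `N ≤ ρ₀L³`, and every exact zero-free minimiser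
`Φ` — Bose–Einstein condensation of the exact periodic ground states uniformly in the thermodynamic
limit at low density (`c = 1/C₁`, `C₁` the stub's constant at `p = 1`), by `condensate_floor`.
[folklore] -/
theorem condensation_of_conditionalDensityMoments (h : ConditionalDensityMoments) :
    ∀ v : ℝ → ℝ≥0∞, IsRepulsiveFiniteRange v → (∃ B : ℝ, ∀ r, v r ≤ ENNReal.ofReal B) →
      ∃ ρ₀ c : ℝ, 0 < ρ₀ ∧ 0 < c ∧ ∃ N₀ : ℕ, ∀ m : ℕ, N₀ ≤ m + 1 →
        ∀ L : ℝ, 0 < L → ((m + 1 : ℕ) : ℝ) ≤ ρ₀ * L ^ 3 →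
          ∀ Φ : PeriodicTrialState (m + 1) L,
            periodicEnergy v Φ = periodicGroundStateEnergy v (m + 1) L → (∀ X, Φ.ψ X ≠ 0) →
              ENNReal.ofReal (c * (m + 1 : ℕ)) ≤
                condensateOccupation (m + 1) L (fun X => (‖Φ.ψ X‖ : ℂ)) := by
  intro v hv hB
  obtain ⟨ρ₀, C, hρ₀, hC, N₀, hmain⟩ := h v hv hB 1
  refine ⟨ρ₀, C⁻¹, hρ₀, inv_pos.2 hC, N₀, fun m hm L hL hρ Φ hE hΦ => ?_⟩
  have hmom := hmain m hm L hL hρ Φ hE hΦ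
  set D : ℝ≥0∞ := ∫⁻ X in cellN (m + 1) L,
    ENNReal.ofReal (fibreW Φ X * (L ^ 3 * fibrePsi Φ X ^ 2)⁻¹) with hD
  set n₀ : ℝ≥0∞ := condensateOccupation (m + 1) L (fun X => (‖Φ.ψ X‖ : ℂ)) with hn₀
  -- the inverse moment is one of the two summands of the stub at `p = 1`
  have hDle : D ≤ ENNReal.ofReal (C * L ^ 3) := by
    refine le_trans (lintegral_mono fun X => ENNReal.ofReal_le_ofReal ?_) hmom
    rw [pow_one, pow_one, mul_add]
    exact le_add_of_nonneg_left (mul_nonneg (fibreW_nonneg Φ X)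
      (mul_nonneg (pow_nonneg hL.le 3) (sq_nonneg _)))
  have hfloor := condensate_floor hL Φ hΦ
  have hL3 : ENNReal.ofReal (L ^ 3) ≠ 0 := by
    simpa [ENNReal.ofReal_eq_zero, not_le] using pow_pos hL 3
  have hC' : ENNReal.ofReal C ≠ 0 := by simpa [ENNReal.ofReal_eq_zero, not_le] using hC
  -- `L³·N ≤ n₀·C·L³`, cancel `L³`, multiply by `C⁻¹`
  have h1 : (m + 1 : ℝ≥0∞) * ENNReal.ofReal (L ^ 3) ≤
      n₀ * ENNReal.ofReal C * ENNReal.ofReal (L ^ 3) := by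
    calc (m + 1 : ℝ≥0∞) * ENNReal.ofReal (L ^ 3) = ENNReal.ofReal (L ^ 3) * (m + 1 : ℝ≥0∞) := by
          ring
      _ ≤ n₀ * D := hfloor
      _ ≤ n₀ * ENNReal.ofReal (C * L ^ 3) := by gcongr
      _ = n₀ * ENNReal.ofReal C * ENNReal.ofReal (L ^ 3) := by
          rw [ENNReal.ofReal_mul hC.le, mul_assoc]
  have h2 : (m + 1 : ℝ≥0∞) ≤ n₀ * ENNReal.ofReal C :=
    (ENNReal.mul_le_mul_iff_left hL3 ENNReal.ofReal_ne_top).1 h1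
  have h3 : ENNReal.ofReal C⁻¹ * (m + 1 : ℝ≥0∞) ≤ n₀ := by
    calc ENNReal.ofReal C⁻¹ * (m + 1 : ℝ≥0∞) ≤ ENNReal.ofReal C⁻¹ * (n₀ * ENNReal.ofReal C) := by
          gcongr
      _ = n₀ * (ENNReal.ofReal C⁻¹ * ENNReal.ofReal C) := by ring
      _ = n₀ := by
          rw [ENNReal.ofReal_inv_of_pos hC, ENNReal.inv_mul_cancel hC' ENNReal.ofReal_ne_top,
            mul_one]
  calc ENNReal.ofReal (C⁻¹ * (m + 1 : ℕ)) = ENNReal.ofReal C⁻¹ * (m + 1 : ℝ≥0∞) := by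
        rw [ENNReal.ofReal_mul (inv_nonneg.2 hC.le), ENNReal.ofReal_natCast]
        push_cast
        ring
    _ ≤ n₀ := h3

end Summit.AtomisticToContinuum.BoseEinsteinCondensation.Cruxes.FibreConductance.CondensateFloor

end
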